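import Summits.KontsevichZagierPeriods.KontsevichZagierPeriods.Theorems.RootDecompRelativeModAbsoluteCylLogSplitP15

/-! # `RootDecompRelativeModAbsoluteCylLogSplitP16` — part 16/25 of the mechanical ≤330-line split of `CylLogSplit.lean`
(split by the decomp-kz census seat for landing; mathematics unchanged; part 16 continues part 15). -/

noncomputable section
open Set MeasureTheory Filter Topology
open scoped BigOperators
open Literature.NumberTheory.Transcendental Literature.ModelTheory.ExponentialFields

namespace Summit.KontsevichZagierPeriods.RootDecompRelativeModAbsolute.Rung30571

namespace RegularisedLogLayer

namespace CylLog
variable {b : ℕ}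

/-- **D7, reversed orientation, `k` factors.**  For `0 < Wᵢ ≤ 1` (semialgebraic, differentiable) with
`d·(1 − ∏Wᵢ)^{m+1}/∏Wᵢ ∈ L¹(G)` and honest reversed cells `Rᵢ = P⁻_m(d,Wᵢ)`, the reversed product cell `P⁻_m(d,∏Wᵢ)` and
the base term `[G, d·(polyLog_m ∏Wᵢ − Σ polyLog_m Wᵢ)]` exist and `−[P] + Σᵢ[Rᵢ] − [B] ∈ KZ.relations`. -/
theorem regTorusProductNeg_iter {b m : ℕ} {G : Set (Fin b → ℝ)} {d : (Fin b → ℝ) → ℝ}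
    (hGo : IsOpen G) (hG : IsSemialgebraic ℚ G) (hd : IsSemialgebraicFunOn ℚ G d) :
    ∀ (k : ℕ) (W : Fin k → (Fin b → ℝ) → ℝ),
      (∀ i, IsSemialgebraicFunOn ℚ G (W i)) → (∀ i, DifferentiableOn ℝ (W i) G) →
      (∀ i, ∀ x ∈ G, 0 < W i x) → (∀ i, ∀ x ∈ G, W i x ≤ 1) →
      IntegrableOn (fun x => d x * (1 - ∏ i, W i x) ^ (m + 1) / ∏ i, W i x) G →
      ∀ (R : Fin k → KZ.IntegralRep (b + 1)),
        (∀ i, (R i).domain = KZlog.band G (W i) (fun _ => 1)) →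
        (∀ i, EqOn (R i).integrand
          (fun z => d (Fin.init z) * ((z (Fin.last b) - 1) ^ m / z (Fin.last b))) (R i).domain) →
        ∃ (P : KZ.IntegralRep (b + 1)) (B : KZ.IntegralRep b),
          P.domain = KZlog.band G (fun x => ∏ i, W i x) (fun _ => 1) ∧
          (P.integrand = fun z => d (Fin.init z) * ((z (Fin.last b) - 1) ^ m / z (Fin.last b))) ∧
          B.domain = G ∧
          (B.integrand = fun x => d x * (polyLog m (∏ i, W i x) - ∑ i, polyLog m (W i x))) ∧
          -KZ.of P + ∑ i, KZ.of (R i) - KZ.of B ∈ KZ.relations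
  | 0, W, hW, hWd, hW0, hW1, hint, R, hRd, hRi => by
    have hGm : MeasurableSet G := hG.measurableSet_holds
    obtain ⟨P, hPd, hPi⟩ := exists_regRep_of_integrableOn_pow' (m := m) (W := fun x => ∏ i, W i x)
      hG hd (isSemialgebraicFunOn_fin_prod hG hW) (fun x _ => by simp) (fun x _ => by simp) hint
    have hBsa := isSemialgebraicFunOn_polyLogDefect (m := m) hG hd hW
    have hBint : IntegrableOn
        (fun x => d x * (polyLog m (∏ i, W i x) - ∑ i, polyLog m (W i x))) G := by
      refine (integrableOn_zero : IntegrableOn (fun _ : Fin b → ℝ => (0:ℝ)) G).congr_fun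
        (fun x _ => ?_) hGm
      simp [polyLog_one]
    set B : KZ.IntegralRep b :=
      { domain := G
        integrand := fun x => d x * (polyLog m (∏ i, W i x) - ∑ i, polyLog m (W i x))
        isSemialgebraic_domain := hG
        isSemialgebraicFunOn_integrand := hBsa
        integrableOn := hBint } with hB
    refine ⟨P, B, hPd, hPi, rfl, rfl, ?_⟩
    have hP : KZ.of P ∈ KZ.relations := by
      refine KZ.of_mem_relations_of_volume_eq_zero P ?_
      rw [hPd]
      refine measure_mono_null (fun z hz => ?_) (KZ.volume_setOf_last_eq_zero (n := b) 1)
      obtain ⟨_, h1, h2⟩ := hz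
      have h1' : ∏ i : Fin 0, W i (Fin.init z) ≤ z (Fin.last b) := h1
      have h2' : z (Fin.last b) ≤ 1 := h2
      simp only [Finset.univ_eq_empty, Finset.prod_empty] at h1'
      exact le_antisymm h2' h1'
    have hB0 : KZ.of B ∈ KZ.relations :=
      KZ.of_mem_relations_of_eqOn_zero B fun x _ => by simp [hB, polyLog_one]
    have e : -KZ.of P + ∑ i : Fin 0, KZ.of (R i) - KZ.of B = -KZ.of P - KZ.of B := by simp
    rw [e]
    exact sub_mem (neg_mem hP) hB0
  | k + 1, W, hW, hWd, hW0, hW1, hint, R, hRd, hRi => by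
    have hGm : MeasurableSet G := hG.measurableSet_holds
    set Pk : (Fin b → ℝ) → ℝ := fun x => ∏ i : Fin k, W (Fin.castSucc i) x with hPk
    have hQsa : IsSemialgebraicFunOn ℚ G Pk :=
      isSemialgebraicFunOn_fin_prod hG (W := fun i => W (Fin.castSucc i)) fun i => hW _
    have hQd : DifferentiableOn ℝ Pk G :=
      differentiableOn_fin_prod (W := fun i => W (Fin.castSucc i)) fun i => hWd _
    have hQ0 : ∀ x ∈ G, 0 < Pk x := fun x hx => fin_prod_pos' fun i => hW0 _ x hx
    have hQ1 : ∀ x ∈ G, Pk x ≤ 1 := fun x hx =>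
      fin_prod_le_one' (fun i => hW0 _ x hx) fun i => hW1 _ x hx
    have hl0 : ∀ x ∈ G, 0 < W (Fin.last k) x := hW0 (Fin.last k)
    have hl1 : ∀ x ∈ G, W (Fin.last k) x ≤ 1 := hW1 (Fin.last k)
    have hprod : ∀ x, ∏ i, W i x = Pk x * W (Fin.last k) x := fun x => by
      simp [hPk, Fin.prod_univ_castSucc]
    have hQW0 : ∀ x ∈ G, 0 < Pk x * W (Fin.last k) x := fun x hx => mul_pos (hQ0 x hx) (hl0 x hx)
    have hQle : ∀ x ∈ G, Pk x * W (Fin.last k) x ≤ Pk x := fun x hx =>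
      mul_le_of_le_one_right (hQ0 x hx).le (hl1 x hx)
    -- integrability of the partial-product bound (domination)
    have hint' : IntegrableOn
        (fun x => d x * (1 - Pk x * W (Fin.last k) x) ^ (m + 1) / (Pk x * W (Fin.last k) x)) G :=
      hint.congr_fun (fun x _ => by
        show d x * (1 - ∏ i, W i x) ^ (m + 1) / ∏ i, W i x =
          d x * (1 - Pk x * W (Fin.last k) x) ^ (m + 1) / (Pk x * W (Fin.last k) x)
        rw [hprod]) hGm
    have hintk : IntegrableOn (fun x => d x * (1 - Pk x) ^ (m + 1) / Pk x) G := by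
      have hsa : IsSemialgebraicFunOn ℚ G (fun x => d x * (1 - Pk x) ^ (m + 1) / Pk x) :=
        IsSemialgebraicFunOn.div (IsSemialgebraicFunOn.mul_holds hd (isSemialgebraicFunOn_pow' hG
          ((IsSemialgebraicFunOn.sub_holds (isSemialgebraicFunOn_ratCast hG 1) hQsa).congr
            fun x _ => by simp) (m + 1))) hQsa fun x hx => (hQ0 x hx).ne'
      refine Integrable.mono' hint'.norm (KZ.aestronglyMeasurable_of_isSemialgebraicFunOn hsa hGm) ?_
      filter_upwards [ae_restrict_mem hGm] with x hx
      rw [Real.norm_eq_abs, Real.norm_eq_abs, mul_div_assoc, mul_div_assoc, abs_mul, abs_mul,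
        abs_of_nonneg (div_nonneg (pow_nonneg (sub_nonneg.mpr (hQ1 x hx)) (m + 1)) (hQ0 x hx).le),
        abs_of_nonneg (div_nonneg (pow_nonneg (sub_nonneg.mpr ((hQle x hx).trans (hQ1 x hx))) (m + 1))
          (hQW0 x hx).le)]
      exact mul_le_mul_of_nonneg_left (gneg_mono m (hQW0 x hx) (hQle x hx) (hQ1 x hx)) (abs_nonneg _)
    -- induction hypothesis on the first k factors
    obtain ⟨P', Bk, hPkd, hPki, hBkd, hBki, hrelk⟩ :=
      regTorusProductNeg_iter hGo hG hd k (fun i => W (Fin.castSucc i)) (fun i => hW _) (fun i => hWd _)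
        (fun i => hW0 _) (fun i => hW1 _) hintk (fun i => R (Fin.castSucc i)) (fun i => hRd _)
        (fun i => hRi _)
    -- the product cell and the new base defect exist
    obtain ⟨P, hPd, hPi⟩ := exists_regRep_of_integrableOn_pow' (m := m) (W := fun x => ∏ i, W i x)
      hG hd (isSemialgebraicFunOn_fin_prod hG hW)
      (fun x hx => fin_prod_pos' fun i => hW0 i x hx)
      (fun x hx => fin_prod_le_one' (fun i => hW0 i x hx) fun i => hW1 i x hx) hint
    obtain ⟨B', hB'd, hB'i⟩ :=
      exists_baseRep_rho_neg (m := m) hG hd hQsa (hW (Fin.last k)) hQ0 hQ1 hl0 hl1 hint'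
    -- one two-factor torus product (pattern Neg)
    have hstep : -KZ.of P + KZ.of P' + KZ.of (R (Fin.last k)) - KZ.of B' ∈ KZ.relations :=
      regTorusProductNeg hGo hG hd hQsa (hW (Fin.last k)) hQd hQ0 hQ1 hl0 hl1 P P' (R (Fin.last k)) B'
        (by rw [hPd]; congr 1; funext x; exact hprod x) (fun z _ => by rw [hPi])
        hPkd (fun z _ => by rw [hPki]) (hRd (Fin.last k)) (hRi (Fin.last k))
        hB'd (fun x _ => by rw [hB'i])
    -- the telescoped base term
    have hBsa := isSemialgebraicFunOn_polyLogDefect (m := m) hG hd hW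
    have hsum : ∀ x, d x * (polyLog m (∏ i, W i x) - ∑ i, polyLog m (W i x)) =
        Bk.integrand x + B'.integrand x := fun x => by
      rw [hBki, hB'i]
      simp only [rho, hPk, Fin.prod_univ_castSucc, Fin.sum_univ_castSucc]
      ring
    have hBk_int : IntegrableOn Bk.integrand G := by
      have h := Bk.integrableOn
      rwa [hBkd] at h
    have hB'_int : IntegrableOn B'.integrand G := by
      have h := B'.integrableOn
      rwa [hB'd] at h
    have hBint : IntegrableOn
        (fun x => d x * (polyLog m (∏ i, W i x) - ∑ i, polyLog m (W i x))) G :=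
      (hBk_int.add hB'_int).congr_fun (fun x _ => (hsum x).symm) hGm
    set B : KZ.IntegralRep b :=
      { domain := G
        integrand := fun x => d x * (polyLog m (∏ i, W i x) - ∑ i, polyLog m (W i x))
        isSemialgebraic_domain := hG
        isSemialgebraicFunOn_integrand := hBsa
        integrableOn := hBint } with hB
    have hBrel : KZ.of B - KZ.of Bk - KZ.of B' ∈ KZ.relations :=
      KZ.integrandAddRel_subset_relations ⟨b, B, Bk, B', hBkd, hB'd, fun x _ => hsum x, rfl⟩
    refine ⟨P, B, hPd, hPi, rfl, rfl, ?_⟩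
    have e : -KZ.of P + ∑ i : Fin (k + 1), KZ.of (R i) - KZ.of B =
        (-KZ.of P + KZ.of P' + KZ.of (R (Fin.last k)) - KZ.of B') +
          (-KZ.of P' + ∑ i : Fin k, KZ.of (R (Fin.castSucc i)) - KZ.of Bk) -
          (KZ.of B - KZ.of Bk - KZ.of B') := by
      rw [Fin.sum_univ_castSucc]
      abel
    rw [e]
    exact sub_mem (add_mem hstep hrelk) hBrel

/-! ### §3r D7 IN LEAN — an EXACT MULTIPLICATIVE RELATION of arbitrary sign pattern (PROVED)
Write the relation `∏ Wᵢ^{fᵢ} = 1` (fᵢ ∈ ℤ) with positive exponents on both sides and split each side by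
ORIENTATION: `(∏U)(∏U') = (∏V)(∏V')` with `U, V ≥ 1` and `U', V' ∈ (0,1]` (repetitions encode `|fᵢ|`).  On a cell
where the common value `L` is oriented (`≥ 1` or `≤ 1` throughout — D1 refines to this), the ORIENTED signed sum of the
regularised cells is a BASE TERM with semialgebraic integrand: the logarithms cancel by the relation.  Assembled from
§3p (Pos-iteration), §3q (Neg-iteration) and ONE Mixed junction per side (patterns `Mixed₁` / `Mixed₂`). -/

/-- Auxiliary step `band_congr_left`. [bookkeeping] -/
theorem band_congr_left {b : ℕ} {s : Set (Fin b → ℝ)} {a a' c : (Fin b → ℝ) → ℝ} (h : EqOn a a' s) :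
    KZlog.band s a c = KZlog.band s a' c := by
  ext z
  simp only [KZlog.band, mem_setOf_eq]
  constructor
  · rintro ⟨hz, h1, h2⟩
    exact ⟨hz, h hz ▸ h1, h2⟩
  · rintro ⟨hz, h1, h2⟩
    exact ⟨hz, (h hz).symm ▸ h1, h2⟩

/-- Three base representations over the same base add up to one. -/
theorem exists_rep_add3 {b : ℕ} {G : Set (Fin b → ℝ)} (hG : IsSemialgebraic ℚ G)
    (B₁ B₂ B₃ : KZ.IntegralRep b) (h₁ : B₁.domain = G) (h₂ : B₂.domain = G) (h₃ : B₃.domain = G) :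
    ∃ X : KZ.IntegralRep b, X.domain = G ∧
      (X.integrand = fun x => B₁.integrand x + B₂.integrand x + B₃.integrand x) ∧
      KZ.of X - KZ.of B₁ - KZ.of B₂ - KZ.of B₃ ∈ KZ.relations := by
  have i₁ := B₁.integrableOn; rw [h₁] at i₁
  have i₂ := B₂.integrableOn; rw [h₂] at i₂
  have i₃ := B₃.integrableOn; rw [h₃] at i₃
  have s₁ := B₁.isSemialgebraicFunOn_integrand; rw [h₁] at s₁
  have s₂ := B₂.isSemialgebraicFunOn_integrand; rw [h₂] at s₂
  have s₃ := B₃.isSemialgebraicFunOn_integrand; rw [h₃] at s₃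
  let X₁₂ : KZ.IntegralRep b :=
    { domain := G
      integrand := fun x => B₁.integrand x + B₂.integrand x
      isSemialgebraic_domain := hG
      isSemialgebraicFunOn_integrand := IsSemialgebraicFunOn.add_holds s₁ s₂
      integrableOn := i₁.add i₂ }
  let X : KZ.IntegralRep b :=
    { domain := G
      integrand := fun x => B₁.integrand x + B₂.integrand x + B₃.integrand x
      isSemialgebraic_domain := hG
      isSemialgebraicFunOn_integrand := IsSemialgebraicFunOn.add_holds (IsSemialgebraicFunOn.add_holds s₁ s₂) s₃
      integrableOn := (i₁.add i₂).add i₃ }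
  have r₁₂ : KZ.of X₁₂ - KZ.of B₁ - KZ.of B₂ ∈ KZ.relations :=
    KZ.integrandAddRel_subset_relations ⟨b, X₁₂, B₁, B₂, h₁, h₂, fun x _ => rfl, rfl⟩
  have r : KZ.of X - KZ.of X₁₂ - KZ.of B₃ ∈ KZ.relations :=
    KZ.integrandAddRel_subset_relations ⟨b, X, X₁₂, B₃, rfl, h₃, fun x _ => rfl, rfl⟩
  refine ⟨X, rfl, rfl, ?_⟩
  have e : KZ.of X - KZ.of B₁ - KZ.of B₂ - KZ.of B₃ =
      (KZ.of X - KZ.of X₁₂ - KZ.of B₃) + (KZ.of X₁₂ - KZ.of B₁ - KZ.of B₂) := by abel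
  rw [e]
  exact add_mem r r₁₂

end CylLog
end RegularisedLogLayer
end Summit.KontsevichZagierPeriods.RootDecompRelativeModAbsolute.Rung30571
end
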